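import Mathlib
import HarnessLib

/-!
# Motivic door — the analytic rigidity core of "no dual Sonin vector at `S = {∞, p}`" (pub-rhdoor seat lad-3)

HONEST FRAMING (verbatim, governs every line below): lottery ticket at the motivic door; RH probability
negligible; consolation prizes are real: a new semi-local Weil-positivity theorem, or a located gap in
the Connes–Consani programme, plus the ff-door theorem.

WHAT IS PROVED HERE (label PROVED): the rigidity lemma
`eq_zero_of_dilation_eq` — if `g : ℝ → ℂ` is real-analytic on all of `ℝ`, `1 < p`, and
`g (p * x) = g x / p` for every `x ≥ c`, then `g = 0` — together with its two halves
(`dilation_eq_everywhere`: the identity theorem propagates the relation from `[c, ∞)` to `ℝ`;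
`eq_zero_of_dilation_eq_everywhere`: iterating `g x = g (x / p ^ n) / p ^ n` and letting `n → ∞`).

WHY (label DERIVED, *not* formalised here — the reduction is recorded in the cell's
`pub-rhdoor-lad-3/LADDER-lad3.md` §B7(2)): in the semilocal Connes–Consani framework at the places
`S = {∞, p}` the "corner" operator is `B_S f = 1_{[-1,1]} · U_p (F f)` with
`U_p h = (1 - 1/p) Σ_{k ≥ 0} h(p^k ·) - (1/p) h(·/p)` (an `L²`-convergent lacunary dilation sum) and
`F` the Fourier transform.  For `f ∈ L²[-1,1]`, `g = F f` is entire (Paley–Wiener); writing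
`G = Σ_{k≥0} g(p^k ·)` one has `U_p g = G - (1/p) G(·/p)` and `g = G - G(p ·)`, so the support
condition "`U_p g = 0` off `[-1,1]`" forces `g (p y) = g y / p` for `|y| ≥ 1/p`, whence `g = 0` by the
lemma below and `f = 0`: the two projections `1 - P` (support in the unit ball) and `1 - ℙ^S` have
trivial intersection, every Connes–Consani block angle satisfies `cos θ_n = |μ_n| < 1`, and the
remainder `ε_S` of their Theorem 27 is termwise well defined at `S ∋ p`.  Only the analytic core is
kernel-checked; the operator-theoretic reduction (infinite sums in `L²`) is prose.

DATA vs PROVED: every `theorem` here is PROVED (standard axioms); no number in this file is DATA.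
-/

open Filter Topology

namespace Summit.RiemannHypothesis.RiemannHypothesis.Theorems.MotivicDoor.DualSonin

/-- Identity-theorem half: a real-analytic `g` with `g (p x) = g x / p` on a half-line satisfies it
everywhere. -/
theorem dilation_eq_everywhere {p c : ℝ} {g : ℝ → ℂ} (hg : AnalyticOnNhd ℝ g Set.univ)
    (h : ∀ x, c ≤ x → g (p * x) = g x / (p : ℂ)) : ∀ x, g (p * x) = g x / (p : ℂ) := by
  -- `F x := g (p x) - g x / p` is real-analytic on `ℝ` and vanishes on `(c, ∞)`.
  set F : ℝ → ℂ := fun x => g (p * x) - g x / (p : ℂ) with hF_def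
  have hF : AnalyticOnNhd ℝ F Set.univ := by
    intro x _
    have h1 : AnalyticAt ℝ (fun y : ℝ => g (p * y)) x := by
      have hmul : AnalyticAt ℝ (fun y : ℝ => p * y) x := analyticAt_const.mul analyticAt_id
      exact (hg (p * x) (Set.mem_univ _)).comp hmul
    have h2 : AnalyticAt ℝ (fun y : ℝ => g y / (p : ℂ)) x := by
      have : AnalyticAt ℝ (fun y : ℝ => g y * ((p : ℂ)⁻¹)) x :=
        (hg x (Set.mem_univ _)).mul analyticAt_const
      simpa [div_eq_mul_inv] using this
    exact h1.sub h2
  have hFz : F =ᶠ[𝓝 (c + 1)] 0 := by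
    have hmem : Set.Ioi c ∈ 𝓝 (c + 1) := Ioi_mem_nhds (by linarith)
    filter_upwards [hmem] with x hx
    have hx' : c ≤ x := le_of_lt hx
    simp [hF_def, h x hx']
  have hzero : Set.EqOn F 0 Set.univ :=
    hF.eqOn_zero_of_preconnected_of_eventuallyEq_zero isPreconnected_univ (Set.mem_univ _) hFz
  intro x
  have := hzero (Set.mem_univ x)
  simpa [hF_def, sub_eq_zero] using this

/-- Iteration half: if `g (p x) = g x / p` for all real `x` with `1 < p` and `g` is continuous at `0`,
then `g = 0`. -/
theorem eq_zero_of_dilation_eq_everywhere {p : ℝ} (hp : 1 < p) {g : ℝ → ℂ}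
    (hg0 : ContinuousAt g 0) (h : ∀ x, g (p * x) = g x / (p : ℂ)) : g = 0 := by
  have hp0 : (0 : ℝ) < p := lt_trans zero_lt_one hp
  have hpC : (p : ℂ) ≠ 0 := by exact_mod_cast hp0.ne'
  -- the relation read inward: `g y = g (y / p) / p`
  have key : ∀ y, g y = g (y / p) / (p : ℂ) := by
    intro y
    have := h (y / p)
    rwa [mul_div_cancel₀ _ hp0.ne'] at this
  -- value at the origin
  have g0 : g 0 = 0 := by
    have h0 := key 0
    rw [zero_div] at h0
    -- `g 0 = g 0 / p` with `p ≠ 1`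
    have hp1 : (p : ℂ) ≠ 1 := by exact_mod_cast (ne_of_gt hp)
    have : g 0 * ((p : ℂ) - 1) = 0 := by
      have e : g 0 * (p : ℂ) = g 0 := by
        calc g 0 * (p : ℂ) = g 0 / (p : ℂ) * (p : ℂ) := by rw [← h0]
          _ = g 0 := div_mul_cancel₀ _ hpC
      calc g 0 * ((p : ℂ) - 1) = g 0 * (p : ℂ) - g 0 := by ring
        _ = 0 := by rw [e, sub_self]
    rcases mul_eq_zero.mp this with h1 | h1
    · exact h1
    · exact absurd (sub_eq_zero.mp h1) hp1
  -- iterate: `g y = g (y / p ^ n) / p ^ n`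
  have iter : ∀ n : ℕ, ∀ y, g y = g (y / p ^ n) / (p : ℂ) ^ n := by
    intro n
    induction n with
    | zero => intro y; simp
    | succ n ih =>
      intro y
      rw [ih y, key (y / p ^ n), div_div, div_div, ← pow_succ, ← pow_succ']
  funext x
  -- `‖g x‖ ≤ ‖g (x / p ^ n)‖ → ‖g 0‖ = 0`
  have hbound : ∀ n : ℕ, ‖g x‖ ≤ ‖g (x / p ^ n)‖ := by
    intro n
    rw [iter n x, norm_div, norm_pow, Complex.norm_real, Real.norm_of_nonneg hp0.le]
    exact div_le_self (norm_nonneg _) (one_le_pow₀ hp.le)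
  have hlim : Tendsto (fun n : ℕ => x / p ^ n) atTop (𝓝 0) := by
    have h1 : Tendsto (fun n : ℕ => (p⁻¹) ^ n) atTop (𝓝 0) :=
      tendsto_pow_atTop_nhds_zero_of_lt_one (inv_nonneg.mpr hp0.le) (inv_lt_one_of_one_lt₀ hp)
    have h2 : Tendsto (fun n : ℕ => x * (p⁻¹) ^ n) atTop (𝓝 (x * 0)) := h1.const_mul x
    rw [mul_zero] at h2
    refine h2.congr' (Eventually.of_forall fun n => ?_)
    simp [div_eq_mul_inv, inv_pow]
  have hglim : Tendsto (fun n : ℕ => ‖g (x / p ^ n)‖) atTop (𝓝 0) := by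
    have : Tendsto (fun n : ℕ => g (x / p ^ n)) atTop (𝓝 (g 0)) := hg0.tendsto.comp hlim
    rw [g0] at this
    simpa using this.norm
  have hle : ‖g x‖ ≤ 0 :=
    le_of_tendsto_of_tendsto' tendsto_const_nhds hglim hbound
  have : ‖g x‖ = 0 := le_antisymm hle (norm_nonneg _)
  simpa using this

/-- THE RIGIDITY LEMMA (analytic core of "no dual Sonin vector at `S = {∞, p}`"): a real-analytic
`g : ℝ → ℂ` with `g (p x) = g x / p` on a half-line `[c, ∞)`, `1 < p`, is identically zero. -/
theorem eq_zero_of_dilation_eq {p c : ℝ} (hp : 1 < p) {g : ℝ → ℂ} (hg : AnalyticOnNhd ℝ g Set.univ)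
    (h : ∀ x, c ≤ x → g (p * x) = g x / (p : ℂ)) : g = 0 :=
  eq_zero_of_dilation_eq_everywhere hp (hg 0 (Set.mem_univ _)).continuousAt
    (dilation_eq_everywhere hg h)

/-- The same with the hypothesis on `|x| ≥ c` (the form produced by the even, two-sided support
condition of the semilocal reduction). -/
theorem eq_zero_of_dilation_eq_abs {p c : ℝ} (hp : 1 < p) {g : ℝ → ℂ}
    (hg : AnalyticOnNhd ℝ g Set.univ) (h : ∀ x, c ≤ |x| → g (p * x) = g x / (p : ℂ)) : g = 0 :=
  eq_zero_of_dilation_eq (c := |c|) hp hg fun x hx =>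
    h x ((le_abs_self c).trans (hx.trans (le_abs_self x)))

end Summit.RiemannHypothesis.RiemannHypothesis.Theorems.MotivicDoor.DualSonin
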